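import Summits.ValiantsHypothesis.ValiantsHypothesis.Theorems.KPlusLogSqLawTridiagonalRealStaticPotentialRow

/-!
# Route «KPlusLogSqLaw», crux `WeakLifting` (stmt-ValiantsHypothesis-19561) — REAL side of the tridiagonal sector:
# the TYPED-CURRENCY BRIDGE — every continuant row `Z ≤ #posRoots(pathDet a d b f m)` with positive diagonal coefficients is a row of the
# desk's α currency (R2102/R2114), and refutes the law `B m ≤ Z − 1`

HONEST FRAMING.  Helper (`--supports stmt-ValiantsHypothesis-19561 --as helper`), seat val-sym-lift-p3 (g14), cell `pub-symmetroid`, 2026-08-28.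
Pure bookkeeping, all sizes: the rows of the lineage are certified in the continuant currency `pathDet a d b f m` of
`…TridiagonalRealStaticPotentialDefs` (four sequences: diagonal coefficients / exponents `a, d`, link coefficients / exponents `b, f`), while the
desk's α target is typed over monomial matrices `of (fun i j => C (c i j) * X ^ (e i j))` with `c`, `e` symmetric, `c = 0` off the band and
positive diagonal coefficients.  Each row file so far re-did the translation by hand (`det_of_eq_pathDet` + four `pathDet_congr` obligations on
explicit `if`-tables).  This file does it ONCE:
* `exists_typed_of_pathDet` — if `0 < a t` for `t < m` and `Z ≤ #posRoots(pathDet a d b f m)`, then the band tables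
  `c i j = a i | b (min i j) | 0`, `e i j = d i | f (min i j) | 0` give a typed design of size `m` with at least `Z` distinct positive
  determinant zeros;
* `not_law_of_pathDet` — consequently `B m ≤ Z − 1` is not a law of the static definite tridiagonal sector.
Nothing here is an upper bound or a new row; nothing bears on `WeakLifting` / `TropicalB` (stmt-19771) in their windows, Conjecture B, the Door-A
registers, `MatrixDescartes` (stmt-ValiantsHypothesis-18050) or VP ≠ VNP.  [bookkeeping]
-/

-- `Summit.ValiantsHypothesis.ValiantsHypothesis.…` repeats a component by the D-0017 layout (single-conjunct summit); the name is mandated.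
set_option linter.dupNamespace false
set_option autoImplicit false

namespace Summit.ValiantsHypothesis.ValiantsHypothesis.Theorems.KPlusLogSqLaw.StaticTridiagonalRealTyped

open Polynomial
open Summit.ValiantsHypothesis.ValiantsHypothesis.Theorems.KPlusLogSqLaw.StaticTridiagonalRealPotential
  (pathDet pathDet_congr det_of_eq_pathDet)

/-- **Continuant rows are typed rows.**  If the diagonal coefficients below `m` are positive and `pathDet a d b f m` has at least `Z` distinct
positive roots, then there is a STATIC DEFINITE symmetric tridiagonal `m × m` monomial matrix `of (fun i j => C (c i j) * X ^ (e i j))` in the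
desk's typed currency (`c`, `e` symmetric, `c = 0` off the band, `0 < c i i`) with at least `Z` distinct positive determinant zeros — namely the
band tables of `(a, d, b, f)`. [bookkeeping] -/
theorem exists_typed_of_pathDet (a : ℕ → ℝ) (d : ℕ → ℕ) (b : ℕ → ℝ) (f : ℕ → ℕ) (m Z : ℕ) (ha : ∀ t, t < m → 0 < a t)
    (hZ : Z ≤ ((pathDet a d b f m).roots.toFinset.filter (fun t => 0 < t)).card) :
    ∃ (c : Fin m → Fin m → ℝ) (e : Fin m → Fin m → ℕ),
      (∀ i j, c i j = c j i) ∧ (∀ i j, e i j = e j i) ∧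
      (∀ i j : Fin m, (i : ℕ) + 1 < j ∨ (j : ℕ) + 1 < i → c i j = 0) ∧ (∀ i, 0 < c i i) ∧
      Z ≤ ((Matrix.det (Matrix.of fun i j => C (c i j) * (X : ℝ[X]) ^ (e i j))).roots.toFinset.filter
        (fun t => 0 < t)).card := by
  refine ⟨fun i j => if (j : ℕ) = i then a i else if (j : ℕ) = i + 1 then b i else if (i : ℕ) = j + 1 then b j else 0,
    fun i j => if (j : ℕ) = i then d i else if (j : ℕ) = i + 1 then f i else if (i : ℕ) = j + 1 then f j else 0,
    ?_, ?_, ?_, ?_, ?_⟩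
  · intro i j
    dsimp only
    split_ifs <;> first | rfl | (exfalso; omega) | (have : i = j := Fin.ext (by omega); subst this; rfl)
  · intro i j
    dsimp only
    split_ifs <;> first | rfl | (exfalso; omega) | (have : i = j := Fin.ext (by omega); subst this; rfl)
  · intro i j hij
    dsimp only
    split_ifs <;> first | rfl | (exfalso; omega)
  · intro i
    simp only [if_true]
    exact ha i i.isLt
  · have hdet : (Matrix.det (Matrix.of fun i j : Fin m =>
        C ((fun i j : Fin m => if (j : ℕ) = i then a i else if (j : ℕ) = i + 1 then b i else if (i : ℕ) = j + 1 then b j else 0) i j) *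
          (X : ℝ[X]) ^ ((fun i j : Fin m => if (j : ℕ) = i then d i else if (j : ℕ) = i + 1 then f i
            else if (i : ℕ) = j + 1 then f j else 0) i j))) = pathDet a d b f m := by
      rw [det_of_eq_pathDet]
      · refine pathDet_congr (fun t ht => ?_) (fun t ht => ?_) (fun t ht => ?_) (fun t ht => ?_)
        · rw [dif_pos ht]; simp
        · rw [dif_pos ht]; simp
        · rw [dif_pos ht]; simp
        · rw [dif_pos ht]; simp
      · intro i j
        split_ifs <;> first | rfl | (exfalso; omega) | (have : i = j := Fin.ext (by omega); subst this; rfl)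
      · intro i j
        split_ifs <;> first | rfl | (exfalso; omega) | (have : i = j := Fin.ext (by omega); subst this; rfl)
      · intro i j hij
        split_ifs <;> first | rfl | (exfalso; omega)
    rw [hdet]
    exact hZ

/-- **`B m ≤ Z − 1` is not a law** once a continuant row `Z ≤ #posRoots(pathDet a d b f m)` with positive diagonal coefficients exists.
[corollary] -/
theorem not_law_of_pathDet (a : ℕ → ℝ) (d : ℕ → ℕ) (b : ℕ → ℝ) (f : ℕ → ℕ) (m Z : ℕ) (ha : ∀ t, t < m → 0 < a t)
    (hZ : Z + 1 ≤ ((pathDet a d b f m).roots.toFinset.filter (fun t => 0 < t)).card) :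
    ¬ (∀ (c : Fin m → Fin m → ℝ) (e : Fin m → Fin m → ℕ), (∀ i j, c i j = c j i) → (∀ i j, e i j = e j i) →
        (∀ i j : Fin m, (i : ℕ) + 1 < j ∨ (j : ℕ) + 1 < i → c i j = 0) → (∀ i, 0 < c i i) →
        ((Matrix.det (Matrix.of fun i j => C (c i j) * (X : ℝ[X]) ^ (e i j))).roots.toFinset.filter
          (fun t : ℝ => 0 < t)).card ≤ Z) := by
  intro hlaw
  obtain ⟨c, e, hc, he, hband, hpos, hcard⟩ := exists_typed_of_pathDet a d b f m (Z + 1) ha hZ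
  have := hlaw c e hc he hband hpos
  omega

end Summit.ValiantsHypothesis.ValiantsHypothesis.Theorems.KPlusLogSqLaw.StaticTridiagonalRealTyped
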